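import Mathlib.LinearAlgebra.Matrix.Permanent
import Mathlib.Algebra.MvPolynomial.Rename
import Mathlib.Algebra.BigOperators.Ring.Finset
import Literature.LinearAlgebra.Matrix.PermanentLaplace
import Literature.LinearAlgebra.Matrix.PermanentSubperm
import Literature.LinearAlgebra.Matrix.PermanentBypass
import Literature.Combinatorics.SimpleGraph.MatchingMinor
import Literature.Combinatorics.SimpleGraph.PerfectMatchingPoly
import Literature.Computability.AlgebraicComplexity.ValiantClasses
import HarnessLib

/-!
# Matching minors and Valiant projections, I: edge deletion and central subgraphs

Topic `Combinatorics/SimpleGraph`. Companion to `MatchingMinor.lean` (definition item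
`defn-IsMatchingMinor` of route `ValiantsHypothesis/PolyaContinued`, wanted API (i): "each
matching-minor operation — edge deletion, passage to a conformal subgraph, bicontraction — makes
`PM_H` a Valiant projection of `PM_G`, hence `dc(PM_H) ≤ dc(PM_G)`").

For a bipartite graph in the route's edge-set encoding `E : Finset (Fin n × Fin n)` (rows ×
columns of `K_{n,n}`), the **perfect-matching polynomial** `PM_E = per (X|_E)` is the tree's
`perfectMatchingPoly E k` (`PerfectMatchingPoly.lean`: the permanent of the Edmonds matrix; by
`perfectMatchingPoly_eq_permanent` it is `rfl`-equal to the expression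
`(Matrix.of fun i j => if (i, j) ∈ E then X (i, j) else 0).permanent` that the route
`PolyaContinued` inlines in its items). This file and its sequels prove that every matching-minor
operation turns `PM` into a VALIANT PROJECTION (substitution of variables and constants,
`Literature.Computability.AlgebraicComplexity.IsProjection`).

## Contents

* `aeval_perfectMatchingPoly`: a substitution `x_e ↦ a e` acts entrywise on the Edmonds matrix,
  `PM_E (a) = per (a|_E)` (any finite vertex type `V`, any `k`-algebra);
* two small permanent lemmas: `permanent_map` (ring homs commute with `per`; the tree's
  `Matrix.permanent_map_ringHom` sits behind the heavy `PermanentCompleteness` imports, so the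
  one-liner is replayed), `permanent_submatrix_equiv_pair` (reindexing rows and columns by two
  possibly different bijections), and the expansion `permanent_of_ite` of the permanent of a
  matrix supported on a relation as a sum over the permutations inside the relation. The rest of
  the permanent toolkit is REUSED from `Literature/LinearAlgebra/Matrix/`: Laplace expansion
  `Matrix.permanent_eq_sum_row_zero` (`PermanentLaplace`), column additivity
  `Matrix.permanent_updateCol_add` (`PermanentBypass`), block-triangular matrices
  `Matrix.permanent_fromBlocks_zero₂₁` (`PermanentSubperm`);
* **edge deletion** (`isProjection_perfectMatchingPoly_of_subset`, any finite `V`): if `H ⊆ G`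
  on the same vertex set then `PM_H = PM_G (x_e ↦ 0, e ∉ H)` is a projection of `PM_G`;
* **central (conformal) subgraphs** (`IsCentralSubgraph.isProjection_perfectMatchingPoly`): if
  `IsCentralSubgraph K G` (`MatchingMinor.lean`: the rows/columns of `K ⊆ K_{l,l}` embed into
  those of `G ⊆ K_{n,n}` by `r, c`, edges into edges, and `G ∖ V(K)` has the perfect matching
  `τ`), then `PM_K = PM_G (x_{r i, c j} ↦ x_{ij} for (i, j) ∈ K; x_{i, τ i} ↦ 1 off V(K);
  every other x_e ↦ 0)` (`aeval_centralSubst_perfectMatchingPoly`): after reindexing rows by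
  `Fin l ⊕ (rows ∖ range r)` and columns by
  `Fin l ⊕ (columns ∖ range c) ≃ Fin l ⊕ (rows ∖ range r)` (through `τ`) the substituted
  matrix is block-diagonal `[X|_K 0; 0 1]`, of permanent `PM_K · 1`.

Bicontraction, isomorphism invariance and the assembled statements
`IsMatchingMinor H G → IsProjection PM_H PM_G → dc PM_H ≤ dc PM_G` are in the sequel files
`MatchingMinorBicontraction.lean`, `MatchingMinorIsomorphism.lean`, `MatchingMinorMonotone.lean`.

## References

* L. G. Valiant, *Completeness classes in algebra*, STOC 1979 (projections). [Valiant1979]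
* N. Robertson, P. D. Seymour, R. Thomas, *Permanents, Pfaffian orientations, and even directed
  circuits*, Ann. of Math. 150 (1999) 929–975, §1 (central subgraphs), §4 (bicontraction, weak
  containment = matching minors). [RobertsonSeymourThomas1999]
-/

namespace Literature.Combinatorics.SimpleGraph

open MvPolynomial Equiv Finset Matrix

/-! ### Permanent toolkit -/

section Permanent

variable {ι : Type*} [DecidableEq ι] [Fintype ι] {R S : Type*} [CommSemiring R] [CommSemiring S]

/-- Ring homomorphisms commute with the permanent (`per` is a polynomial in the entries); the
same one-liner as the tree's `Matrix.permanent_map_ringHom` (`PermanentCompleteness.lean`, not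
imported here to keep this file light). [folklore] -/
theorem permanent_map (M : Matrix ι ι R) (f : R →+* S) :
    (M.map f).permanent = f M.permanent := by
  simp [permanent, map_sum, map_prod]

/-- Reindexing rows and columns by two (possibly different) bijections preserves the permanent
(unlike the determinant, no sign appears); the one-bijection case is
`Matrix.permanent_submatrix_equiv` (`PermanentLaplace`). [folklore] -/
theorem permanent_submatrix_equiv_pair {κ : Type*} [DecidableEq κ] [Fintype κ]
    (M : Matrix ι ι R) (e₁ e₂ : κ ≃ ι) :
    (M.submatrix e₁ e₂).permanent = M.permanent := by
  have h1 : M.submatrix e₁ e₂ =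
      (M.submatrix id (e₁.symm.trans e₂)).submatrix e₁ e₁ := by
    ext i j
    simp
  rw [h1, Matrix.permanent_submatrix_equiv, permanent_permute_rows]

/-- The permanent of a matrix with entries `if p i j then f i j else 0` is the sum, over the
permutations `σ` all of whose cells `(σ j, j)` satisfy `p`, of `∏ⱼ f (σ j) j` — for the
symbolic biadjacency matrix: the sum over perfect matchings of their monomials. [folklore] -/
theorem permanent_of_ite (p : ι → ι → Prop) [DecidableRel p] (f : ι → ι → R) :
    (Matrix.of fun i j => if p i j then f i j else 0).permanent =
      ∑ σ : Perm ι, if ∀ j, p (σ j) j then ∏ j, f (σ j) j else 0 := by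
  unfold permanent
  refine Finset.sum_congr rfl fun σ _ => ?_
  simp only [of_apply]
  rw [Finset.prod_ite_zero]
  simp

end Permanent

/-! ### Substitutions act entrywise on the Edmonds matrix -/

section PM

variable {k : Type*} [CommSemiring k] {V : Type*} [DecidableEq V] [Fintype V]

/-- **Substitution acts entrywise**: for any `k`-algebra map given by `x_e ↦ a e`,
`PM_E (a) = per (a|_E)`, the permanent of the matrix with `a (i, j)` at the edges and `0`
elsewhere (cf. `eval_perfectMatchingPoly` of `PerfectMatchingPoly.lean`, the case of scalar
weights). [folklore] -/
theorem aeval_perfectMatchingPoly {A : Type*} [CommSemiring A] [Algebra k A]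
    (a : V × V → A) (E : Finset (V × V)) :
    aeval a (perfectMatchingPoly E k) =
      (Matrix.of fun i j => if (i, j) ∈ E then a (i, j) else 0 : Matrix V V A).permanent := by
  rw [perfectMatchingPoly_eq_permanent, ← RingHom.coe_coe, ← permanent_map]
  congr 1
  ext i j
  simp only [map_apply, of_apply, RingHom.coe_coe]
  split_ifs <;> simp

/-! ### Edge deletion -/

/-- The edge-deletion substitution: keep `x_e` for `e ∈ H`, send the other variables to `0`.
[folklore] -/
noncomputable def deleteSubst (H : Finset (V × V)) : V × V → MvPolynomial (V × V) k :=
  fun e => if e ∈ H then MvPolynomial.X e else 0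

/-- Deleting edges is a substitution: for `H ⊆ G` on the same vertex set,
`PM_H = PM_G (x_e ↦ 0, e ∉ H)`. [folklore] -/
theorem aeval_deleteSubst_perfectMatchingPoly {H G : Finset (V × V)} (h : H ⊆ G) :
    aeval (deleteSubst (k := k) H) (perfectMatchingPoly G k) = perfectMatchingPoly H k := by
  rw [aeval_perfectMatchingPoly, perfectMatchingPoly_eq_permanent]
  congr 1
  ext i j
  simp only [of_apply, deleteSubst]
  by_cases hH : (i, j) ∈ H
  · simp [hH, h hH]
  · simp [hH]

/-- **Edge deletion is a projection** (Valiant): if `H ⊆ G ⊆ K_{V,V}` then `PM_H` is a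
projection of `PM_G` (substitute `0` for the deleted edge variables). [folklore] -/
theorem isProjection_perfectMatchingPoly_of_subset {H G : Finset (V × V)} (h : H ⊆ G) :
    Literature.Computability.AlgebraicComplexity.IsProjection
      (perfectMatchingPoly H k) (perfectMatchingPoly G k) := by
  refine ⟨deleteSubst (k := k) H, fun e => ?_, (aeval_deleteSubst_perfectMatchingPoly h).symm⟩
  by_cases he : e ∈ H
  · exact Or.inl ⟨e, by simp [deleteSubst, he]⟩
  · exact Or.inr ⟨0, by simp [deleteSubst, he]⟩

end PM

/-! ### Central (conformal) subgraphs -/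

section Central

variable {k : Type*} [CommSemiring k] {l n : ℕ}

/-- Rows of `K_{n,n}` split as (the image of) the rows of `K` and the rest:
`Fin l ⊕ {i // i ∉ range r} ≃ Fin n`, `inl i ↦ r i`, `inr x ↦ x`. [folklore] -/
noncomputable def rowSplitEquiv (r : Fin l ↪ Fin n) :
    Fin l ⊕ {i : Fin n // i ∉ Set.range r} ≃ Fin n :=
  open scoped Classical in
  (Equiv.sumCongr (Equiv.ofInjective r r.injective) (Equiv.refl _)).trans
    (Equiv.sumCompl fun i => i ∈ Set.range r)

/-- `rowSplitEquiv r (inl i) = r i`. [folklore] -/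
@[simp] theorem rowSplitEquiv_inl (r : Fin l ↪ Fin n) (i : Fin l) :
    rowSplitEquiv r (Sum.inl i) = r i := by
  simp [rowSplitEquiv]

/-- `rowSplitEquiv r (inr x) = x`. [folklore] -/
@[simp] theorem rowSplitEquiv_inr (r : Fin l ↪ Fin n) (x : {i : Fin n // i ∉ Set.range r}) :
    rowSplitEquiv r (Sum.inr x) = x := by
  simp [rowSplitEquiv]

/-- Columns of `K_{n,n}` split as the columns of `K` and the rest, the rest being identified with
the complementary ROWS through the perfect matching `τ` of `G ∖ V(K)`:
`inl j ↦ c j`, `inr x ↦ τ x`. [folklore] -/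
noncomputable def colSplitEquiv (r c : Fin l ↪ Fin n)
    (τ : {i : Fin n // i ∉ Set.range r} ≃ {j : Fin n // j ∉ Set.range c}) :
    Fin l ⊕ {i : Fin n // i ∉ Set.range r} ≃ Fin n :=
  (Equiv.sumCongr (Equiv.refl _) τ).trans (rowSplitEquiv c)

/-- `colSplitEquiv r c τ (inl j) = c j`. [folklore] -/
@[simp] theorem colSplitEquiv_inl (r c : Fin l ↪ Fin n)
    (τ : {i : Fin n // i ∉ Set.range r} ≃ {j : Fin n // j ∉ Set.range c}) (j : Fin l) :
    colSplitEquiv r c τ (Sum.inl j) = c j := by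
  simp [colSplitEquiv]

/-- `colSplitEquiv r c τ (inr x) = τ x`. [folklore] -/
@[simp] theorem colSplitEquiv_inr (r c : Fin l ↪ Fin n)
    (τ : {i : Fin n // i ∉ Set.range r} ≃ {j : Fin n // j ∉ Set.range c})
    (x : {i : Fin n // i ∉ Set.range r}) :
    colSplitEquiv r c τ (Sum.inr x) = τ x := by
  simp [colSplitEquiv]

/-- The block-diagonal matrix `[X|_K 0; 0 1]` on `Fin l ⊕ (rows ∖ range r)`: the symbolic
biadjacency matrix of `K` and an identity block (the perfect matching `τ` of `G ∖ V(K)` set to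
`1`). [folklore] -/
noncomputable def centralBlocks (K : Finset (Fin l × Fin l)) (ρ : Type*) [DecidableEq ρ] :
    Matrix (Fin l ⊕ ρ) (Fin l ⊕ ρ) (MvPolynomial (Fin l × Fin l) k) :=
  Matrix.fromBlocks
    (Matrix.of fun i j => if (i, j) ∈ K then MvPolynomial.X (i, j) else 0) 0 0 1

/-- The **central-subgraph substitution** on the edge variables of `G ⊆ K_{n,n}`:
`x_{r i, c j} ↦ x_{ij}` if `(i, j) ∈ K` (and `↦ 0` if not), `x_{i, τ i} ↦ 1` for the
complementary rows `i`, every other variable `↦ 0`; packaged as the entries of `centralBlocks`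
read through the row/column splittings. [folklore] -/
noncomputable def centralSubst (K : Finset (Fin l × Fin l)) (r c : Fin l ↪ Fin n)
    (τ : {i : Fin n // i ∉ Set.range r} ≃ {j : Fin n // j ∉ Set.range c}) :
    Fin n × Fin n → MvPolynomial (Fin l × Fin l) k :=
  fun e => centralBlocks (k := k) K _ ((rowSplitEquiv r).symm e.1) ((colSplitEquiv r c τ).symm e.2)

/-- Each value of the central-subgraph substitution is a variable or a constant. [folklore] -/
theorem centralSubst_isVarOrConst (K : Finset (Fin l × Fin l)) (r c : Fin l ↪ Fin n)
    (τ : {i : Fin n // i ∉ Set.range r} ≃ {j : Fin n // j ∉ Set.range c})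
    (e : Fin n × Fin n) :
    (∃ e', centralSubst (k := k) K r c τ e = MvPolynomial.X e') ∨
      ∃ a, centralSubst (k := k) K r c τ e = MvPolynomial.C a := by
  unfold centralSubst centralBlocks
  rcases (rowSplitEquiv r).symm e.1 with i | x <;> rcases (colSplitEquiv r c τ).symm e.2 with j | y
  · simp only [fromBlocks_apply₁₁, of_apply]
    split_ifs
    · exact Or.inl ⟨_, rfl⟩
    · exact Or.inr ⟨0, by simp⟩
  · exact Or.inr ⟨0, by simp⟩
  · exact Or.inr ⟨0, by simp⟩
  · simp only [fromBlocks_apply₂₂, one_apply]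
    split_ifs
    · exact Or.inr ⟨1, by simp⟩
    · exact Or.inr ⟨0, by simp⟩

/-- **A central subgraph is a substitution instance.** With the data of `IsCentralSubgraph K G`
(row/column embeddings `r, c`, edges of `K` mapped into `G`, and a perfect matching `τ` of
`G ∖ V(K)` inside `G`): `PM_K = PM_G (centralSubst K r c τ)`. [folklore] -/
theorem aeval_centralSubst_perfectMatchingPoly {K : Finset (Fin l × Fin l)}
    {G : Finset (Fin n × Fin n)} (r c : Fin l ↪ Fin n) (hK : ∀ e ∈ K, (r e.1, c e.2) ∈ G)
    (τ : {i : Fin n // i ∉ Set.range r} ≃ {j : Fin n // j ∉ Set.range c})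
    (hτ : ∀ i : {i : Fin n // i ∉ Set.range r}, ((i : Fin n), ((τ i : _) : Fin n)) ∈ G) :
    aeval (centralSubst (k := k) K r c τ) (perfectMatchingPoly G k) = perfectMatchingPoly K k := by
  rw [aeval_perfectMatchingPoly]
  -- the substituted matrix IS the block matrix, reindexed (entries off `G` vanish anyway)
  have hA : (Matrix.of fun i j =>
        if (i, j) ∈ G then centralSubst (k := k) K r c τ (i, j) else 0 :
      Matrix (Fin n) (Fin n) (MvPolynomial (Fin l × Fin l) k)) =
      (centralBlocks (k := k) K _).submatrix (rowSplitEquiv r).symm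
        (colSplitEquiv r c τ).symm := by
    ext i j
    simp only [of_apply, submatrix_apply, centralSubst]
    split_ifs with hG
    · rfl
    · -- off `G` the block entry is `0`
      obtain ⟨x, rfl⟩ := (rowSplitEquiv r).surjective i
      obtain ⟨y, rfl⟩ := (colSplitEquiv r c τ).surjective j
      simp only [Equiv.symm_apply_apply]
      rcases x with i' | x <;> rcases y with j' | y
      · simp only [centralBlocks, fromBlocks_apply₁₁, of_apply]
        rw [if_neg]
        intro hK'
        exact hG (by simpa using hK _ hK')
      · simp [centralBlocks]
      · simp [centralBlocks]
      · simp only [centralBlocks, fromBlocks_apply₂₂, one_apply]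
        rw [if_neg]
        rintro rfl
        exact hG (by simpa using hτ x)
  rw [hA, permanent_submatrix_equiv_pair, centralBlocks, Matrix.permanent_fromBlocks_zero₂₁,
    permanent_one, mul_one, perfectMatchingPoly_eq_permanent]

/-- **Central subgraphs give projections.** If `K` is a central (conformal) subgraph of `G`
(`IsCentralSubgraph K G`), then `PM_K` is a Valiant projection of `PM_G`. [folklore] -/
theorem IsCentralSubgraph.isProjection_perfectMatchingPoly {K : Finset (Fin l × Fin l)}
    {G : Finset (Fin n × Fin n)} (h : IsCentralSubgraph K G) :
    Literature.Computability.AlgebraicComplexity.IsProjection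
      (perfectMatchingPoly K k) (perfectMatchingPoly G k) := by
  obtain ⟨r, c, hK, τ, hτ⟩ := h
  exact ⟨centralSubst K r c τ, centralSubst_isVarOrConst K r c τ,
    (aeval_centralSubst_perfectMatchingPoly r c hK τ hτ).symm⟩

end Central

end Literature.Combinatorics.SimpleGraph
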